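import Literature.NumberTheory.Automorphic.AsaiAtOneOfAsaiHolomorphy
import Literature.NumberTheory.Automorphic.AsaiSignContOfRawPole
import HarnessLib

/-!
# Mok's Asai-pole dichotomy from Grbac–Shahidi's holomorphy clause (2)(a) and the Jacquet–Shalika
# facts AT `s = 1` only (no boundary fact on `Re s = 1`)

Topic `NumberTheory/Automorphic`; namespace `Literature.NumberTheory.Automorphic`.  Proof file
(theorems only: no definition, no named fact, no instance), sequel of `AsaiSignContOfAsaiHolomorphy`
(provefact unit `Mok2014_partialAsaiL_continuation_pole_dichotomy`, 2026-08-16, fifth session — a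
second, distinct decomposition of the same closed-modulo proof).

## What is proved, and what changes

`AsaiSignContOfAsaiHolomorphy` derives the named fact
`Mok2014_partialAsaiL_continuation_pole_dichotomy` (Mok, Mem. AMS 1108, §2.5 and Thm. 2.5.4 (a))
from FIVE inputs: Grbac–Shahidi's Thm. 4.3 (1), (2)(a) in `L²_cusp` (`hGS`, the statement wanted as
the named fact `GrbacShahidi2015_partialAsaiL_holomorphy`) and the four `L²` facts `h22`
(`JacquetShalika1981_partialPairL_at_one_of_ne_conj`, Arthur–Clozel (2.2) at `s = 1`), `h22'`
(`JacquetShalika1981_partialPairL_boundary_of_ne_one`, (2.2) on the line `Re s = 1` off `s = 1`,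
WITH Shahidi's non-vanishing there), `h23` (`JacquetShalika1981_partialPairL_pole_of_eq_conj`, (2.3))
and `hm1` (`multiplicity_one_gl`).  Here the same fact is derived from FOUR of them, and from LESS of
the first:

* `h22'` — the deepest of the Rankin–Selberg inputs (holomorphy AND non-vanishing of
  `L^S(s, π × σ)` on the whole line `Re s = 1`) — is NOT used;
* of Grbac–Shahidi's theorem only clause (2)(a) is used ("`L(s, σ, r_A)` is entire, except for
  possible simple poles at `s = 0` and `s = 1`": `s (s - 1) L^S(s, Π₀, As^η)` is the restriction of
  an entire function, hypothesis `hGSa` below), never clause (1) (the non-Galois-self-dual case).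

So Mok's dichotomy rests on exactly the printed ingredients of Mok, p. 20 / Grbac–Shahidi, p. 206:
the holomorphy of the two Asai `L`-functions, the simple pole of `L^S(s, Π × Π^∨)` at `s = 1`
(Jacquet–Shalika (2.3)), and strong multiplicity one in its Rankin–Selberg form ((2.2) at `s = 1`
with multiplicity one, to pass from "conjugate self-dual at almost every place" to `Π^c = Π̄` in
`L²_cusp`).

## The one new argument: the normalisation `z = 0` from (2)(a) and (2.3)

The only consumer of `h22'` in `AsaiSignContOfAsaiHolomorphy` is the normalisation lemma
`CuspidalAutomorphicRepData.exists_hasSatakeParamAt_iff_L2_of_isConjSelfDualAE`: a conjugate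
self-dual cuspidal Borel–Jacquet datum `Π` has `t_{Π,w} = q_w^{z} t_{P,w}` (`P ≤ L²_cusp(μ)`,
pointwise dictionary, Borel–Jacquet 5.7) with `z = 0`.  There `z ≠ 0` (`Re z = 0` by unitarity) was
excluded by reading `L^T(s, P × P̄) = L^T(s - 2z, P × U_c P)` at `s = 1`: pole on the left ((2.3)),
finite limit on the right ((2.2) at `1 - 2z ≠ 1`, `h22'`).  Here instead
(`….exists_hasSatakeParamAt_iff_L2_of_asaiEntire`): off a finite set, `\bar t_{P,w} = q_w^{2z} t_{P,cw}`,
so the Satake family `A₀ = q^{z} t_P` of `Π` and its conjugate `A₀ ∘ c = q^{-z} \bar t_P` have the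
Rankin–Selberg product `L^{T_E}(s, A₀ × A₀^c) = L^{T_E}(s, P × P̄)` EXACTLY (the shifts cancel,
`partialPairL_eq_of_shift`), while by Mok's factorisation (`partialPairL_smul_eq_partialAsaiL_mul`,
§2.5) and the shift of Asai factors (`partialAsaiL_eq_of_shift`: both tensor slots carry `q^{z}`)
`L^{T_E}(s, A₀ × A₀^c) = L^T(s, A₀, As⁺) L^T(s, A₀, As⁻) = L^T(s - 2z, P, As⁺) L^T(s - 2z, P, As⁻)`
far to the right, `T ⊇` the ramification of `E/F` and of `Π` (an Asai frame, `exists_isAsaiDatum`;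
convergence of the Asai products of `Π` far to the right is the PROVED clause (i),
`exists_multipliable_asaiEulerFactors`).  By (2)(a) for `P` at `T` (both signs) the right side is
`R(s) = G⁺(s - 2z) G⁻(s - 2z) / ((s - 2z)² (s - 2z - 1)²)` with `G^±` entire — a function holomorphic
off `{2z, 2z + 1} ⊂ {Re s = 0} ∪ {Re s = 1}`, in particular on `{1 < Re s}` and, WHEN `z ≠ 0`, at
`s = 1`.  The left side is holomorphic on `{1 < Re s}` (Jacquet–Shalika I, Thm. (5.3), proved in the
tree: `differentiableOn_partialPairL_of_isSatakeFamilyOf`), so the identity persists on `{1 < Re s}`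
(identity theorem, `eqOn_one_lt_re_of_eq_on_lt_re`) and `L^{T_E}(s, P × P̄) → R(1)` as `s → 1⁺` —
contradicting the genuine pole of (2.3) (`h23`, `not_tendsto_partialPairL_conj_of_pole`).  Hence
`z = 0`.  (This is Grbac–Shahidi's own route, §2.A p. 190: the normalisation "trivial on
`A_P(F_∞)°`" is where the possible poles `s = 0, 1` of Thm. 4.3 (2)(a) sit; a unitary twist
`|det|^{z}` moves them to `2z, 1 + 2z`.)

## Results

* `CuspidalAutomorphicRepData.exists_hasSatakeParamAt_iff_L2_of_asaiEntire` — the normalisation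
  (`z = 0`) from `hGSa` and `h23`;
* `CuspidalAutomorphicRepData.pairL_pole_of_isConjSelfDualAE_of_dict`,
  `CuspidalAutomorphicRepData.hol_half_plane_of_asaiEntire_of_dict` — the two hypotheses `hRS`, `hHol`
  of the accepted `Mok2014_partialAsaiL_continuation_pole_dichotomy_of_holomorphy` at every Asai
  datum, from a normalised dictionary (`hdict`) plus `h22`, `h23`, `hm1`, resp. plus `hGSa` (the
  proofs of `AsaiSignContOfAsaiHolomorphy`, with the dictionary abstracted);
* `Mok2014_partialAsaiL_continuation_pole_dichotomy_of_asaiEntire_of_L2` — **the named fact from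
  `hGSa` (Grbac–Shahidi Thm. 4.3 (2)(a) in `L²_cusp`, holomorphy clause only), `h22`, `h23`, `hm1`**;
* `Mok2014_partialAsaiL_continuation_pole_dichotomy_of_asaiHolomorphy_of_L2'` — the same from the
  full requested statement `hGS` (verbatim the hypothesis of
  `Mok2014_partialAsaiL_continuation_pole_dichotomy_of_asaiHolomorphy_of_L2`) and `h22`, `h23`, `hm1`:
  the accepted five-hypothesis theorem with `h22'` deleted.

What this does NOT give: `hGSa` itself (the Langlands–Shahidi method on `U(N, N)`: Grbac–Shahidi
Thm. 2.1, Thm. 4.1 — inside `0 < Re s < 1/2` through Mok's endoscopic classification —, nothing of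
which is formalised), nor the three remaining `L²` facts beyond the ranks where the tree proves them
(`h23`: `N ≤ 2`; `hm1`: `N ≤ 1`).

## References

* C. P. Mok, *Endoscopic classification of representations of quasi-split unitary groups*,
  Mem. Amer. Math. Soc. 235 (2015), no. 1108 (arXiv:1206.0882), §2.5: the paragraph before
  Thm. 2.5.4 (p. 20) and Thm. 2.5.4 (a). [Mok2014]
* N. Grbac, F. Shahidi, *Endoscopic transfer for unitary groups and holomorphy of Asai
  `L`-functions*, Pacific J. Math. 276 (2015), 185–211: §2.A p. 190 (normalisation), Thm. 4.3 (2)(a)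
  (p. 204) and its proof, pp. 204–206. [GrbacShahidi2015]
* J. Arthur, L. Clozel, *Simple algebras, base change, and the advanced theory of the trace formula*,
  Ann. of Math. Stud. 120 (1989), Ch. 3 §2 (2.1)–(2.3). [ArthurClozelAMS120]
* H. Jacquet, J. A. Shalika, *On Euler products and the classification of automorphic
  representations I*, Amer. J. Math. 103 (1981), Thm. (5.3). [JacquetShalikaAJM1981]
* A. Borel, H. Jacquet, *Automorphic forms and automorphic representations*, Corvallis 1979, 5.7.
  [BorelJacquetCorvallis1979]
-/

noncomputable section

open scoped Topology
open NumberField IsDedekindDomain Filter Polynomial MeasureTheory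

namespace Literature.NumberTheory.Automorphic

open AdelicGroupData

/-! ### Two elementary lemmas (private copies of those of `AsaiSignContOfAsaiHolomorphy`, to keep
this file beside rather than above its sibling in the import graph) -/

section Elementary

/-- A positive real number equal to its inverse is `1`. [folklore] -/
private theorem eq_one_of_pos_of_eq_inv_aux {t : ℝ} (ht : 0 < t) (h : t = t⁻¹) : t = 1 := by
  have h2 : t * t = 1 := by
    nth_rewrite 2 [h]
    exact mul_inv_cancel₀ ht.ne'
  rcases mul_self_eq_one_iff.mp h2 with h1 | h1
  · exact h1
  · linarith

/-- `∏ (u • m) = u ^ |m| ∏ m` for a multiset scaled entrywise. [folklore] -/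
private theorem prod_map_const_mul_aux (m : Multiset ℂ) (u : ℂ) :
    (m.map (u * ·)).prod = u ^ Multiset.card m * m.prod := by
  rw [Multiset.prod_map_mul, Multiset.map_const', Multiset.prod_replicate, Multiset.map_id']

end Elementary

/-! ### The normalisation `z = 0` from Grbac–Shahidi (2)(a) and Jacquet–Shalika (2.3) -/

section Normalisation

variable {F E : Type} [Field F] [NumberField F] [Field E] [NumberField E] [Algebra F E]
  {N : ℕ} {hcpt : isCompact_glFiniteIntegralLevel N E}

/-- **A conjugate self-dual cuspidal datum has the Satake parameters of a cuspidal
`P ≤ L²_cusp(GL_N(E) A_G \ GL_N(𝔸_E))` at every finite place** (no twist `|det|^z`), granted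
Grbac–Shahidi's Thm. 4.3 (2)(a) in `L²_cusp` (`hGSa`: `s (s - 1) L^S(s, P, As^η)` is the restriction of
an entire function, for every cuspidal `P ≤ L²_cusp(μ)`, every finite `S` with the inert condition,
every `L²` family of `P` off `S_E`, both signs) and Jacquet–Shalika's (2.3) (`h23`).  By the pointwise
Borel–Jacquet dictionary (`exists_satake_eq_cpow_mul_L2_pointwise`) `t_{Π,v} = q_v^{z} t_{P,v}` at
every `v`; `Re z = 0` by unitarity at one place and its conjugate; and off a finite `c`-stable set
`\bar t_{P,w} = q_w^{2z} t_{P,cw}` (`IsSatakeFamilyOf.map_inv_eq_map_conj` and conjugate self-duality).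
If `z ≠ 0`: at an Asai frame `T ⊇ S` (`exists_isAsaiDatum`) the family `A₀ = q^{z} t_P` of `Π` has
`L^{T_E}(s, A₀ × A₀^c) = L^{T_E}(s, P × P̄)` exactly (`partialPairL_eq_of_shift`, shifts `z`, `-z`),
and far to the right `= L^T(s, A₀, As⁺) L^T(s, A₀, As⁻)` (`partialPairL_smul_eq_partialAsaiL_mul`;
convergence by `exists_multipliable_asaiEulerFactors` and Jacquet–Shalika (5.3))
`= L^T(s - 2z, P, As⁺) L^T(s - 2z, P, As⁻)` (`partialAsaiL_eq_of_shift`)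
`= G⁺(s - 2z) G⁻(s - 2z) / ((s - 2z)² (s - 2z - 1)²)` (`hGSa`), holomorphic off `{2z, 1 + 2z}`, hence on
`{1 < Re s}` and at `s = 1`; the identity persists on `{1 < Re s}` (`eqOn_one_lt_re_of_eq_on_lt_re`,
the left side being holomorphic there, `differentiableOn_partialPairL_of_isSatakeFamilyOf`), so
`L^{T_E}(s, P × P̄)` has a finite limit at `s = 1`, contradicting (2.3)
(`not_tendsto_partialPairL_conj_of_pole`).  (Grbac–Shahidi, §2.A p. 190: "We always assume that `Σ` is
… trivial on `A_P(F_∞)°` … obtained by twisting by a unitary character" — the twist moves the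
possible poles `0, 1` of Thm. 4.3 (2)(a) to `2z, 1 + 2z`.)
[cite: GrbacShahidi2015, §2.A p. 190, Thm. 4.3 (2)(a)] [cite: ArthurClozelAMS120, Ch. 3 §2 (2.3)]
[cite: Mok2014, §2.5, factorisation before Thm. 2.5.4] [cite: BorelJacquetCorvallis1979, 5.7] -/
theorem CuspidalAutomorphicRepData.exists_hasSatakeParamAt_iff_L2_of_asaiEntire {c : E ≃ₐ[F] E}
    (hGSa : ∀ (μ : Measure (gl N E).automorphicQuotient) [(gl N E).IsAutomorphicMeasure μ]
      (P : CuspidalAutomorphicRepGL N E μ) (S : Set (HeightOneSpectrum (𝓞 F))) (A : SatakeFamily E)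
      (η : ℤˣ), S.Finite →
      IsSatakeFamilyOf P {w : HeightOneSpectrum (𝓞 E) | w.under (𝓞 F) ∈ S} A →
      (∀ w : HeightOneSpectrum (𝓞 E), w.under (𝓞 F) ∉ S → c • w = w →
        w.asIdeal.inertiaDeg (𝓞 F) = 2) →
      ∃ σ₀ : ℝ, 1 ≤ σ₀ ∧ ∃ G : ℂ → ℂ, Differentiable ℂ G ∧
        ∀ s : ℂ, σ₀ < s.re → G s = s * (s - 1) * partialAsaiL S c A η s)
    (h23 : ∀ (μ : Measure (gl N E).automorphicQuotient) [(gl N E).IsAutomorphicMeasure μ],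
      JacquetShalika1981_partialPairL_pole_of_eq_conj (n := N) (K := E) (μ := μ))
    (h2 : Module.finrank F E = 2) (hc : c ≠ 1) (hN : 0 < N) (π : CuspidalAutomorphicRepData N E hcpt)
    (hπ : π.1.IsConjSelfDualAE c)
    (μ : Measure (gl N E).automorphicQuotient) [(gl N E).IsAutomorphicMeasure μ] :
    ∃ P : CuspidalAutomorphicRepGL N E μ, ∀ (v : HeightOneSpectrum (𝓞 E)) (β : Multiset ℂ),
      π.1.HasSatakeParamAt v β ↔
        ∃ (𝔫 : Ideal (𝓞 E)) (ϖ : (v.adicCompletion E)ˣ), 𝔫 ≠ 0 ∧ ¬ v.asIdeal ∣ 𝔫 ∧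
          HasSatakeParameterAt P.1 (principalCongruenceLevel N E 𝔫) v ϖ β := by
  classical
  haveI : NeZero N := ⟨hN.ne'⟩
  haveI := infinite_heightOneSpectrum E
  obtain ⟨π₀, h0W', h0π⟩ :=
    CuspidalAutomorphicRepData.exists_clean_hasSatakeParamAt_iff_of_sSup_irreducible
      (AutomorphicRepsGL.stable_cuspidal_eq_sSup_irreducible_holds (hcpt := hcpt)) π
  obtain ⟨z, P, S₁, αP, hS₁, hαP, hdict₁, hdict⟩ :=
    CuspidalAutomorphicRepData.exists_satake_eq_cpow_mul_L2_pointwise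
      (AutomorphicRepsGL.exists_isAssociatedL2_holds hcpt μ) (hasSatakeParamAt_iff_L2_holds hcpt μ)
      π π₀ h0W' h0π
  -- it suffices to show that the twist vanishes
  suffices hz : z = 0 by
    subst hz
    refine ⟨P, fun v β => ?_⟩
    rw [hdict v β]
    simp only [neg_zero, Complex.cpow_zero, one_mul, Multiset.map_id']
  -- the finite failure set `B` of conjugate self-duality, and a finite `c`-stable `SE ⊇ S₁ ∪ B`
  set B : Set (HeightOneSpectrum (𝓞 E)) := {w | ¬ ∀ α β : Multiset ℂ,
      π.1.HasSatakeParamAt w α → π.1.HasSatakeParamAt (c • w) β → β = α.map (·⁻¹)} with hB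
  have hBfin : B.Finite := Filter.eventually_cofinite.mp hπ
  set S : Set (HeightOneSpectrum (𝓞 F)) :=
    (fun w : HeightOneSpectrum (𝓞 E) => w.under (𝓞 F)) '' (S₁ ∪ B) with hS
  have hSfin : S.Finite := (hS₁.union hBfin).image _
  set SE : Set (HeightOneSpectrum (𝓞 E)) := {w | w.under (𝓞 F) ∈ S} with hSE
  have hSEfin : SE.Finite := finite_setOf_under_mem hSfin
  have hS₁SE : S₁ ⊆ SE := fun w hw => ⟨w, Or.inl hw, rfl⟩
  have hcSE : ∀ w : HeightOneSpectrum (𝓞 E), w ∉ SE → c • w ∉ SE := fun w hw h => hw (by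
    have h' : (c • w).under (𝓞 F) ∈ S := h
    rwa [HeightOneSpectrum.under_algEquiv_smul] at h')
  have hgood : ∀ w : HeightOneSpectrum (𝓞 E), w ∉ SE → ∀ α β : Multiset ℂ,
      π.1.HasSatakeParamAt w α → π.1.HasSatakeParamAt (c • w) β → β = α.map (·⁻¹) := by
    intro w hw
    by_contra h
    exact hw ⟨w, Or.inr h, rfl⟩
  -- the Satake family `t_Π = q^z α` of `Π` off `S₁`, conjugate self-dual EXACTLY off `SE`
  set A₀ : SatakeFamily E := fun w => (αP w).map (((w.residueCard : ℂ) ^ z) * ·) with hA₀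
  have hA₀π : ∀ w : HeightOneSpectrum (𝓞 E), w ∉ SE → π.1.HasSatakeParamAt w (A₀ w) :=
    fun w hw => (hdict₁ w (fun h => hw (hS₁SE h)) (A₀ w)).mpr rfl
  have hcsd : ∀ w : HeightOneSpectrum (𝓞 E), w ∉ SE → A₀ (c • w) = (A₀ w).map (·⁻¹) :=
    fun w hw => hgood w hw _ _ (hA₀π w hw) (hA₀π (c • w) (hcSE w hw))
  -- the `L²` family `α` of `P` off `SE`
  have hα : IsSatakeFamilyOf P SE αP := hαP.mono hS₁SE
  -- (i) `Re z = 0` by unitarity at `w₀` and `c w₀`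
  have hzre : z.re = 0 := by
    have hev : ∀ᶠ w : HeightOneSpectrum (𝓞 E) in cofinite, w ∉ SE := hSEfin.compl_mem_cofinite
    obtain ⟨w₀, hw₀⟩ := hev.exists
    obtain ⟨𝔫, -, -, ϖ, hSat⟩ := hα w₀ hw₀
    obtain ⟨𝔫', -, -, ϖ', hSat'⟩ := hα (c • w₀) (hcSE w₀ hw₀)
    set u : ℂ := (w₀.residueCard : ℂ) ^ z with hu
    have hq0 : (w₀.residueCard : ℂ) ≠ 0 := by
      exact_mod_cast (zero_lt_one.trans w₀.one_lt_residueCard).ne'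
    have hu0 : u ≠ 0 := fun h => hq0 ((Complex.cpow_eq_zero_iff _ _).mp h).1
    have hx : ‖(A₀ w₀).prod‖ = ‖u‖ ^ N := by
      show ‖((αP w₀).map (u * ·)).prod‖ = ‖u‖ ^ N
      rw [prod_map_const_mul_aux, norm_mul, norm_pow, hSat.norm_prod_eq_one, mul_one,
        hSat.card_eq]
    have hy : ‖(A₀ (c • w₀)).prod‖ = ‖u‖ ^ N := by
      show ‖((αP (c • w₀)).map ((((c • w₀).residueCard : ℂ) ^ z) * ·)).prod‖ = ‖u‖ ^ N
      rw [residueCard_smul F c w₀, prod_map_const_mul_aux, norm_mul, norm_pow,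
        hSat'.norm_prod_eq_one, mul_one, hSat'.card_eq]
    have hinv : ‖(A₀ (c • w₀)).prod‖ = ‖(A₀ w₀).prod‖⁻¹ := by
      rw [hcsd w₀ hw₀, Multiset.prod_map_inv', norm_inv]
    rw [hx, hy] at hinv
    have ht : ‖u‖ ^ N = 1 := eq_one_of_pos_of_eq_inv_aux (pow_pos (norm_pos_iff.mpr hu0) N) hinv
    have h1 : ‖(A₀ w₀).prod‖ = 1 := by rw [hx, ht]
    exact re_eq_zero_of_norm_prod_eq_one_of_shift hα hN hw₀ rfl h1
  -- (ii) `\bar α(w) = q_w^{2z} α(c w)` off `SE`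
  have hrel : ∀ w : HeightOneSpectrum (𝓞 E), w ∉ SE →
      (αP w).map (starRingEnd ℂ) = (αP (c • w)).map (((w.residueCard : ℂ) ^ (z + z)) * ·) := by
    intro w hw
    have hq0 : (w.residueCard : ℂ) ≠ 0 := by
      exact_mod_cast (zero_lt_one.trans w.one_lt_residueCard).ne'
    have hqz : (w.residueCard : ℂ) ^ z ≠ 0 := fun h => hq0 ((Complex.cpow_eq_zero_iff _ _).mp h).1
    have h2' : (αP (c • w)).map (((w.residueCard : ℂ) ^ z) * ·) =
        ((αP w).map (((w.residueCard : ℂ) ^ z) * ·)).map (·⁻¹) := by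
      have h := hcsd w hw
      simp only [hA₀, residueCard_smul F c w] at h
      exact h
    have h3 : (αP w).map (·⁻¹) =
        ((αP (c • w)).map (((w.residueCard : ℂ) ^ z) * ·)).map (((w.residueCard : ℂ) ^ z) * ·) := by
      rw [h2', Multiset.map_map, Multiset.map_map]
      refine Multiset.map_congr rfl fun a _ => ?_
      show a⁻¹ = (w.residueCard : ℂ) ^ z * ((w.residueCard : ℂ) ^ z * a)⁻¹
      rw [mul_inv, ← mul_assoc, mul_inv_cancel₀ hqz, one_mul]
    rw [← hα.map_inv_eq_map_conj hw, h3, Multiset.map_map]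
    refine Multiset.map_congr rfl fun a _ => ?_
    show (w.residueCard : ℂ) ^ z * ((w.residueCard : ℂ) ^ z * a) = (w.residueCard : ℂ) ^ (z + z) * a
    rw [← mul_assoc, ← Complex.cpow_add _ _ hq0]
  -- (iii) if `2z ≠ 0`: the Rankin–Selberg product of `(A₀, A₀ ∘ c)` is `L(s, P × P̄)` exactly, and
  -- far to the right it is `G⁺(s - 2z) G⁻(s - 2z) / ((s - 2z)² (s - 2z - 1)²)`, holomorphic at `1`
  by_contra hz
  have hzz0 : z + z ≠ 0 := fun h => hz (add_self_eq_zero.mp h)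
  have hzzre : (z + z).re = 0 := by rw [Complex.add_re, hzre, add_zero]
  -- an Asai frame `S' = S ∪ S_a`: finite, with the inert condition off `S'`
  obtain ⟨Sa, Aa, hSa⟩ := AutomorphicRepData.exists_isAsaiDatum h2 hc π.1
  set S' : Set (HeightOneSpectrum (𝓞 F)) := S ∪ Sa with hS'
  have hS'fin : S'.Finite := hSfin.union hSa.finite
  have hSE'fin : {w : HeightOneSpectrum (𝓞 E) | w.under (𝓞 F) ∈ S'}.Finite :=
    finite_setOf_under_mem hS'fin
  have hsub : SE ⊆ {w : HeightOneSpectrum (𝓞 E) | w.under (𝓞 F) ∈ S'} := fun w hw => Or.inl hw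
  have hinert' : ∀ w : HeightOneSpectrum (𝓞 E), w.under (𝓞 F) ∉ S' → c • w = w →
      w.asIdeal.inertiaDeg (𝓞 F) = 2 :=
    fun w hw hcw => hSa.inertiaDeg_eq_two (fun h => hw (Or.inr h)) hcw
  have hSA' : π.1.IsAsaiDatum c S' A₀ :=
    ⟨hS'fin, fun w hw => hA₀π w fun h => hw (Or.inl h), hinert'⟩
  have hα' : IsSatakeFamilyOf P {w : HeightOneSpectrum (𝓞 E) | w.under (𝓞 F) ∈ S'} αP :=
    hα.mono hsub
  have hαc' : IsSatakeFamilyOf P.conj {w : HeightOneSpectrum (𝓞 E) | w.under (𝓞 F) ∈ S'}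
      (fun w => (αP w).map (starRingEnd ℂ)) := hα'.conj
  -- Grbac–Shahidi (2)(a) at `(P, S', α)`, both signs; clause (i) for the Asai products of `A₀`
  obtain ⟨σp, hσp, Gp, hGp, hGpL⟩ := hGSa μ P S' αP 1 hS'fin hα' hinert'
  obtain ⟨σm, hσm, Gm, hGm, hGmL⟩ := hGSa μ P S' αP (-1) hS'fin hα' hinert'
  obtain ⟨σ₁, hσ₁, hmultA⟩ := π.exists_multipliable_asaiEulerFactors h2 hN hSA'
  -- `A₀ = q^{z} α` and `A₀ ∘ c = q^{-z} \bar α` off `S'_E`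
  have hA₀α : ∀ w : HeightOneSpectrum (𝓞 E), w ∉ {w : HeightOneSpectrum (𝓞 E) | w.under (𝓞 F) ∈ S'} →
      A₀ w = (αP w).map (((w.residueCard : ℂ) ^ z) * ·) := fun w _ => rfl
  have hA₀S' : ∀ w : HeightOneSpectrum (𝓞 E), w.under (𝓞 F) ∉ S' →
      A₀ w = (αP w).map (((w.residueCard : ℂ) ^ z) * ·) := fun w _ => rfl
  have hA₀c : ∀ w : HeightOneSpectrum (𝓞 E), w ∉ {w : HeightOneSpectrum (𝓞 E) | w.under (𝓞 F) ∈ S'} →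
      A₀ (c • w) = ((αP w).map (starRingEnd ℂ)).map (((w.residueCard : ℂ) ^ (-z)) * ·) := by
    intro w hw
    have hwSE : w ∉ SE := fun h => hw (hsub h)
    have hq0 : (w.residueCard : ℂ) ≠ 0 := by
      exact_mod_cast (zero_lt_one.trans w.one_lt_residueCard).ne'
    rw [hrel w hwSE, Multiset.map_map]
    show (αP (c • w)).map ((((c • w).residueCard : ℂ) ^ z) * ·) = _
    rw [residueCard_smul F c w]
    refine Multiset.map_congr rfl fun a _ => ?_
    show (w.residueCard : ℂ) ^ z * a =
      (w.residueCard : ℂ) ^ (-z) * ((w.residueCard : ℂ) ^ (z + z) * a)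
    rw [← mul_assoc, ← Complex.cpow_add _ _ hq0, show -z + (z + z) = z by ring]
  have hzcancel : z + -z = 0 := add_neg_cancel z
  -- the Rankin–Selberg product of `(A₀, A₀ ∘ c)` is that of `(α, \bar α)`: the shifts cancel
  have hpairfun : partialPairL {w : HeightOneSpectrum (𝓞 E) | w.under (𝓞 F) ∈ S'} A₀
        (fun w => A₀ (c • w)) =
      partialPairL {w : HeightOneSpectrum (𝓞 E) | w.under (𝓞 F) ∈ S'} αP
        (fun w => (αP w).map (starRingEnd ℂ)) := by
    rw [partialPairL_eq_of_shift (s₁ := z) (s₂ := -z) hA₀α hA₀c]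
    funext s
    rw [hzcancel, sub_zero]
  have hEmult : ∀ s : ℂ, 1 < s.re →
      Multipliable fun w : {w : HeightOneSpectrum (𝓞 E) // w.under (𝓞 F) ∉ S'} =>
        ((satakePairPolynomial (A₀ w.1) (A₀ (c • w.1))).eval ((w.1.residueCard : ℂ) ^ (-s)))⁻¹ := by
    intro s hs
    have hs' : 1 < (s - (z + -z)).re := by rw [hzcancel, sub_zero]; exact hs
    have hmult := JacquetShalika1981_multipliable_partialPairL_holds P P.conj hα' hαc' hs'
    have h := pairEulerFactor_eq_of_shift (s₁ := z) (s₂ := -z) hA₀α hA₀c s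
    exact (congrArg Multipliable h).mpr hmult
  -- far to the right: `L(s, P × P̄) = L^{S'}(s - 2z, P, As⁺) L^{S'}(s - 2z, P, As⁻)`
  set σX : ℝ := max σ₁ (max σp σm) with hσX
  have hσX1 : 1 ≤ σX := hσ₁.trans (le_max_left _ _)
  have hre : ∀ s : ℂ, (s - (z + z)).re = s.re := fun s => by
    rw [Complex.sub_re, hzzre, sub_zero]
  have hfact : ∀ s : ℂ, σX < s.re →
      partialPairL {w : HeightOneSpectrum (𝓞 E) | w.under (𝓞 F) ∈ S'} αP
          (fun w => (αP w).map (starRingEnd ℂ)) s =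
        partialAsaiL S' c αP 1 (s - (z + z)) * partialAsaiL S' c αP (-1) (s - (z + z)) := by
    intro s hs
    have hs₁ : σ₁ < s.re := lt_of_le_of_lt (le_max_left _ _) hs
    have hs1 : 1 < s.re := lt_of_le_of_lt hσ₁ hs₁
    rw [← hpairfun, partialPairL_smul_eq_partialAsaiL_mul h2 hc S' A₀ hinert' (hEmult s hs1)
      (hmultA 1 s hs₁) (hmultA (-1) s hs₁), partialAsaiL_eq_of_shift h2 (S := S') hA₀S' hinert' 1,
      partialAsaiL_eq_of_shift h2 (S := S') hA₀S' hinert' (-1)]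
  -- the meromorphic right-hand side `R`, holomorphic off `{2z, 2z + 1}`
  set R : ℂ → ℂ := fun s =>
    Gp (s - (z + z)) * Gm (s - (z + z)) / ((s - (z + z)) ^ 2 * (s - (z + z) - 1) ^ 2) with hR
  have hRdiff : ∀ s : ℂ, s - (z + z) ≠ 0 → s - (z + z) - 1 ≠ 0 → DifferentiableAt ℂ R s := by
    intro s h0 h1
    have hsh : Differentiable ℂ fun s : ℂ => s - (z + z) := differentiable_id.sub_const _
    have hnum : Differentiable ℂ fun s : ℂ => Gp (s - (z + z)) * Gm (s - (z + z)) :=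
      (hGp.comp hsh).mul (hGm.comp hsh)
    have hden : Differentiable ℂ fun s : ℂ => (s - (z + z)) ^ 2 * (s - (z + z) - 1) ^ 2 :=
      (hsh.pow 2).mul ((hsh.sub_const 1).pow 2)
    exact (hnum s).div (hden s) (mul_ne_zero (pow_ne_zero 2 h0) (pow_ne_zero 2 h1))
  have hne0 : ∀ s : ℂ, 1 ≤ s.re → s - (z + z) ≠ 0 := fun s hs h => by
    have h' := congrArg Complex.re h
    rw [hre, Complex.zero_re] at h'
    linarith
  have hne1 : ∀ s : ℂ, 1 < s.re → s - (z + z) - 1 ≠ 0 := fun s hs h => by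
    have h' := congrArg Complex.re h
    rw [Complex.sub_re, hre, Complex.one_re, Complex.zero_re] at h'
    linarith
  have h1ne1 : (1 : ℂ) - (z + z) - 1 ≠ 0 := by
    rw [sub_sub_cancel_left]
    exact neg_ne_zero.mpr hzz0
  have hRon : DifferentiableOn ℂ R {s : ℂ | 1 < s.re} := fun s hs =>
    (hRdiff s (hne0 s (le_of_lt hs)) (hne1 s hs)).differentiableWithinAt
  have hLon : DifferentiableOn ℂ
      (partialPairL {w : HeightOneSpectrum (𝓞 E) | w.under (𝓞 F) ∈ S'} αP
        (fun w => (αP w).map (starRingEnd ℂ))) {s : ℂ | 1 < s.re} :=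
    differentiableOn_partialPairL_of_isSatakeFamilyOf P P.conj hα' hαc'
  have hagree : ∀ s : ℂ, σX < s.re →
      partialPairL {w : HeightOneSpectrum (𝓞 E) | w.under (𝓞 F) ∈ S'} αP
          (fun w => (αP w).map (starRingEnd ℂ)) s = R s := by
    intro s hs
    have hsp : σp < (s - (z + z)).re := by
      rw [hre]
      exact lt_of_le_of_lt ((le_max_left _ _).trans (le_max_right _ _)) hs
    have hsm : σm < (s - (z + z)).re := by
      rw [hre]
      exact lt_of_le_of_lt ((le_max_right _ _).trans (le_max_right _ _)) hs
    have hs1 : 1 < s.re := lt_of_le_of_lt hσX1 hs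
    have h0 := hne0 s hs1.le
    have h1 := hne1 s hs1
    have hp : partialAsaiL S' c αP 1 (s - (z + z)) =
        Gp (s - (z + z)) / ((s - (z + z)) * (s - (z + z) - 1)) := by
      rw [eq_div_iff (mul_ne_zero h0 h1), hGpL _ hsp]
      ring
    have hm : partialAsaiL S' c αP (-1) (s - (z + z)) =
        Gm (s - (z + z)) / ((s - (z + z)) * (s - (z + z) - 1)) := by
      rw [eq_div_iff (mul_ne_zero h0 h1), hGmL _ hsm]
      ring
    rw [hfact s hs, hp, hm]
    show _ = Gp (s - (z + z)) * Gm (s - (z + z)) / ((s - (z + z)) ^ 2 * (s - (z + z) - 1) ^ 2)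
    rw [div_mul_div_comm]
    congr 1
    ring
  -- identity theorem down to `{1 < Re s}`, then the limit at `s = 1`
  have hEqOn : Set.EqOn
      (partialPairL {w : HeightOneSpectrum (𝓞 E) | w.under (𝓞 F) ∈ S'} αP
        (fun w => (αP w).map (starRingEnd ℂ))) R {s : ℂ | 1 < s.re} :=
    eqOn_one_lt_re_of_eq_on_lt_re hσX1 hLon hRon hagree
  have hR1 : ContinuousAt R 1 :=
    (hRdiff 1 (hne0 1 (le_of_eq Complex.one_re.symm)) h1ne1).continuousAt
  have hlim : Tendsto
      (partialPairL {w : HeightOneSpectrum (𝓞 E) | w.under (𝓞 F) ∈ S'} αP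
        (fun w => (αP w).map (starRingEnd ℂ))) (𝓝[{s : ℂ | 1 < s.re}] 1) (𝓝 (R 1)) := by
    have h : Tendsto R (𝓝[{s : ℂ | 1 < s.re}] 1) (𝓝 (R 1)) :=
      hR1.tendsto.mono_left nhdsWithin_le_nhds
    exact h.congr' (eventually_nhdsWithin_of_forall fun s hs => (hEqOn hs).symm)
  exact not_tendsto_partialPairL_conj_of_pole (h23 μ) hN P P.conj P.conj_conj.symm hSE'fin hα'
    hαc' (R 1) hlim

end Normalisation

/-! ### `hRS` and `hHol` at every Asai datum from a normalised dictionary -/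

section Datum

variable {F E : Type} [Field F] [NumberField F] [Field E] [NumberField E] [Algebra F E]
  {N : ℕ} {hcpt : isCompact_glFiniteIntegralLevel N E}

/-- **`hRS` at every Asai datum of a conjugate self-dual `Π` with a normalised dictionary, from
(2.2) at `s = 1`, (2.3) and multiplicity one.**  This is
`CuspidalAutomorphicRepData.pairL_pole_of_isConjSelfDualAE_of_L2` of `AsaiSignContOfAsaiHolomorphy`
with its first step — the normalised dictionary "`Π` has the Satake parameters of some cuspidal
`P ≤ L²_cusp(μ)` at every finite place", there obtained from `h22'` and `h23` — abstracted into the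
hypothesis `hdict` (for every automorphic measure), so that it can be fed by
`exists_hasSatakeParamAt_iff_L2_of_asaiEntire` instead.  For a quadratic `E/F` with involution `c`
(`c² = 1`), `Π` cuspidal on `GL_N(𝔸_E)` (`N ≥ 1`) conjugate self-dual a.e. and ANY Asai datum `(S, A)`:
`R(s) = L^{S_E}(s, A ⊗ A^c)` is multipliable and holomorphic on `{1 < Re s}` (Jacquet–Shalika I,
Thm. (5.3), for `(P, U_c P)`), and `(s - 1) R(s) → r ≠ 0` as `s → 1⁺` ((2.3) for `(P, U_c P)`, once
`P = \overline{U_c P}` in `L²_cusp` — else (2.2) at `s₀ = 1` (`h22`, through `hm1`) at the datum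
enlarged by the failure set of `A(cw) = A(w)⁻¹`, where `L(s, P × U_c P) = L(s, P × P̄)` factor by
factor, contradicts the pole of the latter).  Mok, §2.5 p. 20: "`L(s, φ^N × (φ^N)^c) = … =
L(s, φ^N × (φ^N)^∨)`, hence has a simple pole at `s = 1` by [JPSS]". [cite: Mok2014, §2.5 p. 20]
[cite: GrbacShahidi2015, proof of Thm. 4.3, p. 206] [cite: ArthurClozelAMS120, Ch. 3 §2 (2.1)–(2.3)] -/
theorem CuspidalAutomorphicRepData.pairL_pole_of_isConjSelfDualAE_of_dict
    (h22 : ∀ (μ : Measure (gl N E).automorphicQuotient) [(gl N E).IsAutomorphicMeasure μ],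
      JacquetShalika1981_partialPairL_at_one_of_ne_conj (n := N) (K := E) (μ := μ))
    (h23 : ∀ (μ : Measure (gl N E).automorphicQuotient) [(gl N E).IsAutomorphicMeasure μ],
      JacquetShalika1981_partialPairL_pole_of_eq_conj (n := N) (K := E) (μ := μ))
    (hm1 : ∀ (μ : Measure (gl N E).automorphicQuotient) [(gl N E).IsAutomorphicMeasure μ],
      multiplicity_one_gl N E μ)
    {c : E ≃ₐ[F] E} (hcc : c * c = 1) (hN : 0 < N) (π : CuspidalAutomorphicRepData N E hcpt)
    (hπ : π.1.IsConjSelfDualAE c)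
    (hdict : ∀ (μ : Measure (gl N E).automorphicQuotient) [(gl N E).IsAutomorphicMeasure μ],
      ∃ P : CuspidalAutomorphicRepGL N E μ, ∀ (v : HeightOneSpectrum (𝓞 E)) (β : Multiset ℂ),
        π.1.HasSatakeParamAt v β ↔
          ∃ (𝔫 : Ideal (𝓞 E)) (ϖ : (v.adicCompletion E)ˣ), 𝔫 ≠ 0 ∧ ¬ v.asIdeal ∣ 𝔫 ∧
            HasSatakeParameterAt P.1 (principalCongruenceLevel N E 𝔫) v ϖ β)
    {S : Set (HeightOneSpectrum (𝓞 F))} {A : SatakeFamily E} (hSA : π.1.IsAsaiDatum c S A) :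
    (∀ s : ℂ, 1 < s.re →
      Multipliable fun w : {w : HeightOneSpectrum (𝓞 E) // w.under (𝓞 F) ∉ S} =>
        ((satakePairPolynomial (A w.1) (A (c • w.1))).eval ((w.1.residueCard : ℂ) ^ (-s)))⁻¹) ∧
    DifferentiableOn ℂ
      (partialPairL {w : HeightOneSpectrum (𝓞 E) | w.under (𝓞 F) ∈ S} A (fun w => A (c • w)))
      {s : ℂ | 1 < s.re} ∧
    ∃ r : ℂ, r ≠ 0 ∧
      Tendsto (fun s => (s - 1) *
          partialPairL {w : HeightOneSpectrum (𝓞 E) | w.under (𝓞 F) ∈ S} A (fun w => A (c • w)) s)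
        (𝓝[{s : ℂ | 1 < s.re}] 1) (𝓝 r) := by
  classical
  haveI : NeZero N := ⟨hN.ne'⟩
  obtain ⟨μ, hμ⟩ := AdelicGroupData.exists_isAutomorphicMeasure_gl_holds (n := N) (K := E)
  haveI := hμ
  have hμG : IsGalInvariant F μ :=
    isGalInvariant_of_unique F (isAutomorphicMeasure_unique_smul_holds N E) μ
  obtain ⟨P, hdictP⟩ := hdict μ
  set SE : Set (HeightOneSpectrum (𝓞 E)) := {w | w.under (𝓞 F) ∈ S} with hSE
  have hSEfin : SE.Finite := finite_setOf_under_mem hSA.finite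
  -- `A` is an `L²` family of `P` off `S_E`, `A ∘ c` one of `U_c P`
  have hα : IsSatakeFamilyOf P SE A := by
    intro w hw
    obtain ⟨𝔫, ϖ, h𝔫, hw𝔫, hSat⟩ := (hdictP w (A w)).mp (hSA.hasSatakeParamAt hw)
    exact ⟨𝔫, h𝔫, hw𝔫, ϖ, hSat⟩
  have hcinv : c⁻¹ = c := inv_eq_of_mul_eq_one_right hcc
  set Pc : CuspidalAutomorphicRepGL N E μ := P.galConj F hμG c with hPc
  have hβ : IsSatakeFamilyOf Pc SE (fun w => A (c • w)) := by
    have h := hα.galConj F hμG c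
    rw [hcinv] at h
    refine h.mono fun w hw => ?_
    show w.under (𝓞 F) ∈ S
    have hw' : (c • w).under (𝓞 F) ∈ S := hw
    rwa [HeightOneSpectrum.under_algEquiv_smul] at hw'
  -- `P = conj (U_c P)` in `L²_cusp`
  have hPeq : P = Pc.conj := by
    by_contra hne
    set B : Set (HeightOneSpectrum (𝓞 E)) := {w | ¬ ∀ α β : Multiset ℂ,
        π.1.HasSatakeParamAt w α → π.1.HasSatakeParamAt (c • w) β → β = α.map (·⁻¹)} with hB
    have hBfin : B.Finite := Filter.eventually_cofinite.mp hπ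
    set S'' : Set (HeightOneSpectrum (𝓞 F)) :=
      S ∪ (fun w : HeightOneSpectrum (𝓞 E) => w.under (𝓞 F)) '' B with hS''
    have hS''fin : S''.Finite := hSA.finite.union (hBfin.image _)
    set SE'' : Set (HeightOneSpectrum (𝓞 E)) := {w | w.under (𝓞 F) ∈ S''} with hSE''
    have hSE''fin : SE''.Finite := finite_setOf_under_mem hS''fin
    have hsub : SE ⊆ SE'' := fun w hw => Or.inl hw
    have hα'' : IsSatakeFamilyOf P SE'' A := hα.mono hsub
    have hβ'' : IsSatakeFamilyOf Pc SE'' (fun w => A (c • w)) := hβ.mono hsub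
    -- off `SE''` the pair factor of `(A, A ∘ c)` is that of `(A, \bar A)`
    have key : ∀ w : HeightOneSpectrum (𝓞 E), w ∉ SE'' → A (c • w) = (A w).map (starRingEnd ℂ) := by
      intro w hw
      have hwS : w.under (𝓞 F) ∉ S := fun h => hw (Or.inl h)
      have hcwS : (c • w).under (𝓞 F) ∉ S := by
        rwa [HeightOneSpectrum.under_algEquiv_smul]
      have hgood : ∀ α β : Multiset ℂ, π.1.HasSatakeParamAt w α →
          π.1.HasSatakeParamAt (c • w) β → β = α.map (·⁻¹) := by
        by_contra h
        exact hw (Or.inr ⟨w, h, rfl⟩)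
      rw [hgood _ _ (hSA.hasSatakeParamAt hwS) (hSA.hasSatakeParamAt hcwS)]
      exact hα.map_inv_eq_map_conj hwS
    have hLL : partialPairL SE'' A (fun w => A (c • w)) =
        partialPairL SE'' A (fun w => (A w).map (starRingEnd ℂ)) := by
      funext s
      unfold partialPairL
      exact tprod_congr fun w => by simp only [key w.1 w.2]
    obtain ⟨r, -, hT⟩ := (h22 μ) hN (hm1 μ) P Pc hne hSE''fin hα'' hβ''
    rw [hLL] at hT
    exact not_tendsto_partialPairL_conj_of_pole (h23 μ) hN P P.conj P.conj_conj.symm hSE''fin hα''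
      hα''.conj r hT
  -- (2.1), Thm. (5.3) and (2.3) for `(P, U_c P)` with the families `(A, A ∘ c)` off `S_E`
  refine ⟨fun s hs => JacquetShalika1981_multipliable_partialPairL_holds P Pc hα hβ hs,
    differentiableOn_partialPairL_of_isSatakeFamilyOf P Pc hα hβ, ?_⟩
  exact (h23 μ) hN P Pc hPeq hSEfin hα hβ

/-- **`hHol` at every Asai datum from Grbac–Shahidi (2)(a) and a normalised dictionary.**  This is
`CuspidalAutomorphicRepData.hol_half_plane_of_asaiHolomorphyL2` of `AsaiSignContOfAsaiHolomorphy` with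
the dictionary abstracted (`hdict`) and only clause (2)(a) of Grbac–Shahidi's theorem assumed
(`hGSa`, for these `F`, `E`, `c`, `N` and every automorphic measure): for `Π` cuspidal on `GL_N(𝔸_E)`
with the Satake parameters of a cuspidal `P ≤ L²_cusp(μ)` at every finite place, an Asai
datum `(S, A)` and a sign `η`, the function `(s - 1) L^S(s, Π, As^η)` continues from some
`{σ₀ < Re s}` (`σ₀ ≥ 1`) to the holomorphic function `G(s) / s` on `{1/2 < Re s}`, `G` the entire
`s (s - 1) L^S(s, P, As^η)` of `hGSa` at `(P, S, A)`. [cite: GrbacShahidi2015, Thm. 4.3 (2)(a)]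
[cite: Mok2014, §2.5 p. 20] -/
theorem CuspidalAutomorphicRepData.hol_half_plane_of_asaiEntire_of_dict {c : E ≃ₐ[F] E}
    (hGSa : ∀ (μ : Measure (gl N E).automorphicQuotient) [(gl N E).IsAutomorphicMeasure μ]
      (P : CuspidalAutomorphicRepGL N E μ) (S : Set (HeightOneSpectrum (𝓞 F))) (A : SatakeFamily E)
      (η : ℤˣ), S.Finite →
      IsSatakeFamilyOf P {w : HeightOneSpectrum (𝓞 E) | w.under (𝓞 F) ∈ S} A →
      (∀ w : HeightOneSpectrum (𝓞 E), w.under (𝓞 F) ∉ S → c • w = w →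
        w.asIdeal.inertiaDeg (𝓞 F) = 2) →
      ∃ σ₀ : ℝ, 1 ≤ σ₀ ∧ ∃ G : ℂ → ℂ, Differentiable ℂ G ∧
        ∀ s : ℂ, σ₀ < s.re → G s = s * (s - 1) * partialAsaiL S c A η s)
    (π : CuspidalAutomorphicRepData N E hcpt)
    (hdict : ∀ (μ : Measure (gl N E).automorphicQuotient) [(gl N E).IsAutomorphicMeasure μ],
      ∃ P : CuspidalAutomorphicRepGL N E μ, ∀ (v : HeightOneSpectrum (𝓞 E)) (β : Multiset ℂ),
        π.1.HasSatakeParamAt v β ↔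
          ∃ (𝔫 : Ideal (𝓞 E)) (ϖ : (v.adicCompletion E)ˣ), 𝔫 ≠ 0 ∧ ¬ v.asIdeal ∣ 𝔫 ∧
            HasSatakeParameterAt P.1 (principalCongruenceLevel N E 𝔫) v ϖ β)
    {S : Set (HeightOneSpectrum (𝓞 F))} {A : SatakeFamily E} (η : ℤˣ)
    (hSA : π.1.IsAsaiDatum c S A) :
    ∃ σ₀ : ℝ, 1 ≤ σ₀ ∧ ∃ G : ℂ → ℂ, DifferentiableOn ℂ G {s : ℂ | 1 / 2 < s.re} ∧
      ∀ s : ℂ, σ₀ < s.re → G s = (s - 1) * partialAsaiL S c A η s := by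
  classical
  obtain ⟨μ, hμ⟩ := AdelicGroupData.exists_isAutomorphicMeasure_gl_holds (n := N) (K := E)
  haveI := hμ
  obtain ⟨P, hdictP⟩ := hdict μ
  have hα : IsSatakeFamilyOf P {w : HeightOneSpectrum (𝓞 E) | w.under (𝓞 F) ∈ S} A := by
    intro w hw
    obtain ⟨𝔫, ϖ, h𝔫, hw𝔫, hSat⟩ := (hdictP w (A w)).mp (hSA.hasSatakeParamAt hw)
    exact ⟨𝔫, h𝔫, hw𝔫, ϖ, hSat⟩
  have hinert : ∀ w : HeightOneSpectrum (𝓞 E), w.under (𝓞 F) ∉ S → c • w = w →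
      w.asIdeal.inertiaDeg (𝓞 F) = 2 := fun w hw hcw => hSA.inertiaDeg_eq_two hw hcw
  obtain ⟨σ₀, hσ₀, G, hG, hGL⟩ := hGSa μ P S A η hSA.finite hα hinert
  refine ⟨σ₀, hσ₀, fun s => G s / s, ?_, ?_⟩
  · intro s hs
    have hs0 : s ≠ 0 := by
      rintro rfl
      simp only [Set.mem_setOf_eq, Complex.zero_re] at hs
      linarith
    exact ((hG s).div differentiableAt_id hs0).differentiableWithinAt
  · intro s hs
    have hs0 : s ≠ 0 := by
      rintro rfl
      rw [Complex.zero_re] at hs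
      linarith
    show G s / s = (s - 1) * partialAsaiL S c A η s
    rw [hGL s hs, mul_assoc, mul_div_cancel_left₀ _ hs0]

end Datum

/-! ### Mok's dichotomy from `hGSa` (Grbac–Shahidi (2)(a)), (2.2) at `s = 1`, (2.3), multiplicity one -/

section Assembly

/-- **Mok's Asai-pole dichotomy (`Mok2014_partialAsaiL_continuation_pole_dichotomy`) from
Grbac–Shahidi's Thm. 4.3 (2)(a) in `L²_cusp` and the Jacquet–Shalika facts at `s = 1`.**
Hypotheses:

* `hGSa` — Grbac–Shahidi 2015, Thm. 4.3 (2)(a), holomorphy clause, partial form, `L²` currency: for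
  every quadratic `E/F` (`c ≠ 1`), `N ≥ 1`, automorphic measure `μ`, cuspidal
  `P ≤ L²_cusp(GL_N(E) A_G \ GL_N(𝔸_E), μ)` (the printed normalisation "trivial on `A_P(F_∞)°`",
  §2.A p. 190), finite `S` off which the `c`-fixed places are inert, `L²` Satake family `A` of `P` off
  `S_E` and sign `η` (`As⁺ = r_A`, `As⁻ = r_A ⊗ δ_{E/F}`), `s (s - 1) L^S(s, P, As^η)` is on some
  `{σ₀ < Re s}` the restriction of an ENTIRE function ("`L(s, σ, r_A)` is entire, except for possible
  simple poles at `s = 0` and `s = 1`"; the removed reciprocal local factors are entire) — the first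
  conjunct of the statement wanted as the named fact `GrbacShahidi2015_partialAsaiL_holomorphy`;
* `h22`, `h23`, `hm1` — the tree's NAMED FACTS `JacquetShalika1981_partialPairL_at_one_of_ne_conj`
  (Arthur–Clozel (2.2) at `s = 1`), `JacquetShalika1981_partialPairL_pole_of_eq_conj` ((2.3)) and
  `multiplicity_one_gl`, over every number field, in every rank, for every automorphic measure.

NOT assumed (contrast `Mok2014_partialAsaiL_continuation_pole_dichotomy_of_asaiHolomorphy_of_L2`):
the boundary fact `JacquetShalika1981_partialPairL_boundary_of_ne_one` ((2.2) with non-vanishing on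
`Re s = 1`, `s ≠ 1`) and Grbac–Shahidi's clause (1).

Proof: the accepted `Mok2014_partialAsaiL_continuation_pole_dichotomy_of_holomorphy` (Mok's order
count at `s = 1` from `L^{S_E}(s, Π × Π^c) = L^S(As⁺) L^S(As⁻)`), with `hHol` from
`hol_half_plane_of_asaiEntire_of_dict` and `hRS` from `pairL_pole_of_isConjSelfDualAE_of_dict`, both
over the normalised dictionary `exists_hasSatakeParamAt_iff_L2_of_asaiEntire` (`z = 0` from (2)(a)
and (2.3)). [cite: Mok2014, §2.5 (paragraph before Thm. 2.5.4) and Thm. 2.5.4 (a), p. 20]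
[cite: GrbacShahidi2015, §2.A p. 190, Thm. 4.3 (2)(a) and its proof, pp. 204–206]
[cite: ArthurClozelAMS120, Ch. 3 §2 (2.1)–(2.3)] [cite: BorelJacquetCorvallis1979, 4.6, 5.7] -/
theorem Mok2014_partialAsaiL_continuation_pole_dichotomy_of_asaiEntire_of_L2
    (hGSa : ∀ (F E : Type) [Field F] [NumberField F] [Field E] [NumberField E] [Algebra F E]
      (c : E ≃ₐ[F] E), Module.finrank F E = 2 → c ≠ 1 →
      ∀ (N : ℕ) (μ : Measure (gl N E).automorphicQuotient) [(gl N E).IsAutomorphicMeasure μ]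
        (P : CuspidalAutomorphicRepGL N E μ), 0 < N →
        ∀ (S : Set (HeightOneSpectrum (𝓞 F))) (A : SatakeFamily E) (η : ℤˣ), S.Finite →
          IsSatakeFamilyOf P {w : HeightOneSpectrum (𝓞 E) | w.under (𝓞 F) ∈ S} A →
          (∀ w : HeightOneSpectrum (𝓞 E), w.under (𝓞 F) ∉ S → c • w = w →
            w.asIdeal.inertiaDeg (𝓞 F) = 2) →
          ∃ σ₀ : ℝ, 1 ≤ σ₀ ∧ ∃ G : ℂ → ℂ, Differentiable ℂ G ∧
            ∀ s : ℂ, σ₀ < s.re → G s = s * (s - 1) * partialAsaiL S c A η s)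
    (h22 : ∀ (E : Type) [Field E] [NumberField E] (N : ℕ)
      (μ : Measure (gl N E).automorphicQuotient) [(gl N E).IsAutomorphicMeasure μ],
      JacquetShalika1981_partialPairL_at_one_of_ne_conj (n := N) (K := E) (μ := μ))
    (h23 : ∀ (E : Type) [Field E] [NumberField E] (N : ℕ)
      (μ : Measure (gl N E).automorphicQuotient) [(gl N E).IsAutomorphicMeasure μ],
      JacquetShalika1981_partialPairL_pole_of_eq_conj (n := N) (K := E) (μ := μ))
    (hm1 : ∀ (E : Type) [Field E] [NumberField E] (N : ℕ)
      (μ : Measure (gl N E).automorphicQuotient) [(gl N E).IsAutomorphicMeasure μ],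
      multiplicity_one_gl N E μ) :
    Mok2014_partialAsaiL_continuation_pole_dichotomy := by
  refine Mok2014_partialAsaiL_continuation_pole_dichotomy_of_holomorphy ?_ ?_
  · intro F E _ _ _ _ _ c h2 hc N hcpt π hN hπ S A η hSA
    have hGSa' := fun (μ : Measure (gl N E).automorphicQuotient) (_ : (gl N E).IsAutomorphicMeasure μ)
      (P : CuspidalAutomorphicRepGL N E μ) (S : Set (HeightOneSpectrum (𝓞 F))) (A : SatakeFamily E)
      (η : ℤˣ) => hGSa F E c h2 hc N μ P hN S A η
    exact π.hol_half_plane_of_asaiEntire_of_dict hGSa'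
      (fun μ _ => π.exists_hasSatakeParamAt_iff_L2_of_asaiEntire hGSa' (h23 E N) h2 hc hN hπ μ) η hSA
  · intro F E _ _ _ _ _ c h2 hc N hcpt π hN hπ S A hSA
    have hGSa' := fun (μ : Measure (gl N E).automorphicQuotient) (_ : (gl N E).IsAutomorphicMeasure μ)
      (P : CuspidalAutomorphicRepGL N E μ) (S : Set (HeightOneSpectrum (𝓞 F))) (A : SatakeFamily E)
      (η : ℤˣ) => hGSa F E c h2 hc N μ P hN S A η
    exact π.pairL_pole_of_isConjSelfDualAE_of_dict (h22 E N) (h23 E N) (hm1 E N)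
      (AlgEquiv.mul_self_eq_one_of_finrank_eq_two h2 c) hN hπ
      (fun μ _ => π.exists_hasSatakeParamAt_iff_L2_of_asaiEntire hGSa' (h23 E N) h2 hc hN hπ μ) hSA

/-- **The accepted five-hypothesis theorem with `h22'` deleted.**  Mok's dichotomy
`Mok2014_partialAsaiL_continuation_pole_dichotomy` from the full requested statement `hGS`
(Grbac–Shahidi Thm. 4.3 (1), (2)(a) in `L²_cusp` — verbatim the hypothesis `hGS` of
`Mok2014_partialAsaiL_continuation_pole_dichotomy_of_asaiHolomorphy_of_L2` and of
`GrbacShahidi2015_partialAsaiL_at_one_of_asaiHolomorphy_of_L2`, the statement wanted as the named fact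
`GrbacShahidi2015_partialAsaiL_holomorphy`) and the named facts
`JacquetShalika1981_partialPairL_at_one_of_ne_conj`, `JacquetShalika1981_partialPairL_pole_of_eq_conj`,
`multiplicity_one_gl` — only the first conjunct of `hGS` is used
(`Mok2014_partialAsaiL_continuation_pole_dichotomy_of_asaiEntire_of_L2`).
[cite: Mok2014, §2.5 and Thm. 2.5.4 (a), p. 20] [cite: GrbacShahidi2015, Thm. 4.3 (1), (2)(a)]
[cite: ArthurClozelAMS120, Ch. 3 §2 (2.2)–(2.3)] -/
theorem Mok2014_partialAsaiL_continuation_pole_dichotomy_of_asaiHolomorphy_of_L2'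
    (hGS : ∀ (F E : Type) [Field F] [NumberField F] [Field E] [NumberField E] [Algebra F E]
      (c : E ≃ₐ[F] E), Module.finrank F E = 2 → c ≠ 1 →
      ∀ (N : ℕ) (μ : Measure (gl N E).automorphicQuotient) [(gl N E).IsAutomorphicMeasure μ]
        (P : CuspidalAutomorphicRepGL N E μ), 0 < N →
        ∀ (S : Set (HeightOneSpectrum (𝓞 F))) (A : SatakeFamily E) (η : ℤˣ), S.Finite →
          IsSatakeFamilyOf P {w : HeightOneSpectrum (𝓞 E) | w.under (𝓞 F) ∈ S} A →
          (∀ w : HeightOneSpectrum (𝓞 E), w.under (𝓞 F) ∉ S → c • w = w →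
            w.asIdeal.inertiaDeg (𝓞 F) = 2) →
          ∃ σ₀ : ℝ, 1 ≤ σ₀ ∧
            (∃ G : ℂ → ℂ, Differentiable ℂ G ∧
              ∀ s : ℂ, σ₀ < s.re → G s = s * (s - 1) * partialAsaiL S c A η s) ∧
            ((¬ ∀ᶠ w : HeightOneSpectrum (𝓞 E) in cofinite, A (c • w) = (A w).map (·⁻¹)) →
              ∃ H : ℂ → ℂ, Differentiable ℂ H ∧
                ∀ s : ℂ, σ₀ < s.re → H s = partialAsaiL S c A η s))
    (h22 : ∀ (E : Type) [Field E] [NumberField E] (N : ℕ)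
      (μ : Measure (gl N E).automorphicQuotient) [(gl N E).IsAutomorphicMeasure μ],
      JacquetShalika1981_partialPairL_at_one_of_ne_conj (n := N) (K := E) (μ := μ))
    (h23 : ∀ (E : Type) [Field E] [NumberField E] (N : ℕ)
      (μ : Measure (gl N E).automorphicQuotient) [(gl N E).IsAutomorphicMeasure μ],
      JacquetShalika1981_partialPairL_pole_of_eq_conj (n := N) (K := E) (μ := μ))
    (hm1 : ∀ (E : Type) [Field E] [NumberField E] (N : ℕ)
      (μ : Measure (gl N E).automorphicQuotient) [(gl N E).IsAutomorphicMeasure μ],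
      multiplicity_one_gl N E μ) :
    Mok2014_partialAsaiL_continuation_pole_dichotomy := by
  refine Mok2014_partialAsaiL_continuation_pole_dichotomy_of_asaiEntire_of_L2 ?_ h22 h23 hm1
  intro F E _ _ _ _ _ c h2 hc N μ _ P hN S A η hS hA hinert
  obtain ⟨σ₀, hσ₀, hG, -⟩ := hGS F E c h2 hc N μ P hN S A η hS hA hinert
  exact ⟨σ₀, hσ₀, hG⟩

end Assembly

end Literature.NumberTheory.Automorphic
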